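import Summits.MatrixMultiplication.OmegaCensus.STPPCosetClashKillsN52
import Summits.MatrixMultiplication.OmegaCensus.STPPCosetQuotientKillN44
import Literature.Combinatorics.Additive.GrynkiewiczPollardKneserTools

/-!
# ω-census (abelian STPP census): `{(2,2,2),(2,3,4),(2,4,3)}` has no STPP realisation in any abelian group of order `52` — Kneser with a `K`-PERIODIC chain (kernel)

HONEST FRAMING (pub-omega census; verbatim): lottery ticket; floor = certified bounds/negative ranges.
Census EXCLUSION (seat pub-omega-stpp-2 gen 31, 2026-08-29), family (b2).  Mechanism of `STPPCosetQuotientKillN44/N46/N57.lean` with one refinement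
(`exists_dvd_kneserLB_le_card_add_of_periodic`: when the first summand is `K`-periodic the Kneser stabilizer contains `K`, so only divisors `d` with
`#K ∣ d` occur — at `52 = 4·13` this removes `d = 13, 26`).  Pattern `{(2,2,2),(2,3,4),(2,4,3)}` (one of the 32 residual patterns of `…KillsN52`): readings
`(A,C,B)` at block `1` and `(A,B,C)` at block `2` give `C₁ = c + K`, `B₂ = b + K`, `K` THE order-4 subgroup; `|(C₂ − A₂) + K| = |(B₁ − A₁) + K| = 24`,
`|B₁ + K| = 12`; Kneser over `d ∈ {4, 52}`: `kLB(24,24,·) ≥ 44`, then `kLB(44,12,·) ≥ 52` ⇒ `−((C₂ − A₂)+K) + ((B₁ − A₁)+K) − (B₁+K) = H ∋ −c`, i.e. the word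
`a₂ − a₁ + b₁ − b₁′ + c₁ − c₂` (reading `(−A,−C,−B)`, indices `(2,1,1)`) vanishes.  Order 52 is then conditional on 31 patterns
(`volume_le_of_card_eq_52_of_dead_q`).  Nothing here is progress on `ω`.

References: M. Kneser, Math. Z. 58 (1953); H. Cohn, R. Kleinberg, B. Szegedy, C. Umans, FOCS 2005 (arXiv:math/0511460), Def. 5.1.
-/

open Finset
open scoped Pointwise

namespace Summit.MatrixMultiplication.OmegaCensus.CubeNB

open Literature.Computability.AlgebraicComplexity
open Literature.Combinatorics.Additive
open Summit.MatrixMultiplication.OmegaCensus.STPPKneser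

variable {H : Type*} [AddCommGroup H] [DecidableEq H] [Fintype H]

/-- **Kneser with a periodic summand**: if `X + K = X` for a subgroup carrier `K`, the stabilizer of `X + Y` contains `K`, so Kneser's bound holds with a
`d = #Stab(X+Y)` that is a MULTIPLE of `#K` (and divides `|H|`). [cite: Kneser1953] -/
theorem exists_dvd_kneserLB_le_card_add_of_periodic {K X Y : Finset H} (hK : IsSubgroupCarrier K) (hXK : X + K = X)
    (hX : X.Nonempty) (hY : Y.Nonempty) :
    ∃ d : ℕ, #K ∣ d ∧ d ∣ Fintype.card H ∧ kneserLB #X #Y d ≤ #(X + Y) := by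
  refine ⟨#(X + Y).addStab, ?_, (hX.add hY).card_addStab_dvd_card_univ, kneserLB_card_addStab_le X Y hX hY⟩
  have hsub : K ⊆ (X + Y).addStab := by
    intro k hk
    refine Grynkiewicz.mem_addStab_of_forall_add_mem (hX.add hY) fun z hz => ?_
    obtain ⟨x, hx, y, hy, rfl⟩ := Finset.mem_add.1 hz
    have hxk : k + x ∈ X := by
      rw [← hXK, add_comm k x]; exact Finset.add_mem_add hx hk
    rw [← add_assoc]
    exact Finset.add_mem_add hxk hy
  exact IsSubgroupCarrier.card_dvd_of_subset hK (IsSubgroupCarrier.of_addStab (hX.add hY)) hsub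

omit [Fintype H] in
/-- `S + K` is `K`-periodic. [folklore] -/
theorem add_carrier_add_carrier {K : Finset H} (hK : IsSubgroupCarrier K) (S : Finset H) : S + K + K = S + K := by
  rw [add_assoc, hK.add_self]

omit [Fintype H] in
/-- `−(S + K)` is `K`-periodic. [folklore] -/
theorem neg_add_carrier_add_carrier {K : Finset H} (hK : IsSubgroupCarrier K) (S : Finset H) : -(S + K) + K = -(S + K) := by
  rw [neg_add_rev, ← hK.neg_eq, ← neg_add_rev, ← neg_add_rev]
  congr 1
  rw [hK.neg_eq, ← add_assoc, add_comm K S, add_assoc, hK.add_self]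

/-- **`{(2,2,2),(2,3,4),(2,4,3)}` has no STPP realisation in any abelian group of order `52`.** [cite: Kneser1953] [cite: CohnKleinbergSzegedyUmans2005, Def. 5.1] -/
theorem no_isSTPP_card52_222_234_243 (hH : Fintype.card H = 52) (A B C : Fin 3 → Finset H) (hS : IsSTPP A B C)
    (hA : ∀ i, #(A i) = ![2, 2, 2] i) (hB : ∀ i, #(B i) = ![2, 3, 4] i) (hC : ∀ i, #(C i) = ![2, 4, 3] i) : False := by
  have hAne : ∀ i, (A i).Nonempty := fun i => card_pos.1 (by rw [hA]; fin_cases i <;> simp)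
  have hBne : ∀ i, (B i).Nonempty := fun i => card_pos.1 (by rw [hB]; fin_cases i <;> simp)
  have hCne : ∀ i, (C i).Nonempty := fun i => card_pos.1 (by rw [hC]; fin_cases i <;> simp)
  have hR : IsSTPP (fun j => -(A j)) (fun j => -(C j)) (fun j => -(B j)) := stpp_rotate (stpp_rotate (isSTPP_neg_reverse hS))
  obtain ⟨K1, hK1, hK1q, t1, -, hs1⟩ := exists_carrier_middle_subset_coset' hR (nonempty_neg_family hAne) (nonempty_neg_family hCne)
    (nonempty_neg_family hBne) 1 ⟨2, by decide⟩ (n := 52) (q := 4) (z := 12) (b := 4) (vol := 24) (a := 2) (L := 16) hH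
    (by simp only [Finset.card_neg, hA]; decide) (by simp only [Finset.card_neg, hC]; decide) (by simp only [Finset.card_neg, hA, hB, hC]; decide)
    (by simp only [Finset.card_neg, hA, hB]; decide) (by simp only [Finset.card_neg, hB, hC]; decide) (by decide)
  have hsub1 : C 1 ⊆ (-t1) +ᵥ K1 := subset_coset_of_neg_subset hK1 hs1
  obtain ⟨K2, hK2, hK2q, t2, -, hs2⟩ := exists_carrier_middle_subset_coset' hS hAne hBne hCne 2 ⟨0, by decide⟩
    (n := 52) (q := 4) (z := 12) (b := 4) (vol := 24) (a := 2) (L := 16) hH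
    (by simp only [hA]; decide) (by simp only [hB]; decide) (by simp only [hA, hB, hC]; decide)
    (by simp only [hA, hC]; decide) (by simp only [hB, hC]; decide) (by decide)
  have hK : K1 = K2 := eq_of_card_eq_coprime hK1 hK2 (m := 13) hK1q hK2q (by rw [hH]) (by decide)
  subst hK
  set K := K1 with hKdef
  have hC1 : C 1 = (-t1) +ᵥ K := Finset.eq_of_subset_of_card_le hsub1 (by rw [Finset.card_vadd_finset, hK1q, hC]; decide)
  have hB2 : B 2 = t2 +ᵥ K := Finset.eq_of_subset_of_card_le hs2 (by rw [Finset.card_vadd_finset, hK1q, hB]; decide)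
  have memC1 : ∀ k ∈ K, -t1 + k ∈ C 1 := fun k hk => by rw [hC1]; exact Finset.mem_vadd_finset.2 ⟨k, hk, rfl⟩
  have memB2 : ∀ k ∈ K, t2 + k ∈ B 2 := fun k hk => by rw [hB2]; exact Finset.mem_vadd_finset.2 ⟨k, hk, rfl⟩
  have hKne : K.Nonempty := hK1.nonempty
  -- |(C₂ − A₂) + K| = 24 (TPP of block 2, second term from K = B₂ − B₂)
  have hD2 : #(D A C 2 + K) = 24 := by
    rw [← Finset.image_add_product, Finset.card_image_of_injOn, Finset.card_product, card_D_AC hS hBne 2, hA, hC, hK1q]; · rfl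
    rintro ⟨d, k⟩ hdk ⟨d', k'⟩ hdk' (h : d + k = d' + k')
    simp only [Finset.coe_product, Set.mem_prod, Finset.mem_coe] at hdk hdk'
    obtain ⟨a, ha, c, hc, rfl⟩ := mem_D.1 hdk.1
    obtain ⟨a', ha', c', hc', rfl⟩ := mem_D.1 hdk'.1
    have hw : (a' - a) + ((t2 + k) - (t2 + k')) + (c - c') = 0 := by
      have : c - a + k - (c' - a' + k') = 0 := sub_eq_zero.2 h
      rw [← this]; abel
    obtain ⟨-, -, h1, h2, h3⟩ := hS 2 2 2 a ha a' ha' (t2 + k') (memB2 k' hdk'.2) (t2 + k) (memB2 k hdk.2) c' hc' c hc hw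
    have hk : k' = k := by simpa using h2
    rw [h1, h3, hk]
  -- |(B₁ − A₁) + K| = 24 and |B₁ + K| = 12 (TPP of block 1, second term from K = C₁ − C₁)
  have hD1 : #(D A B 1 + K) = 24 := by
    rw [← Finset.image_add_product, Finset.card_image_of_injOn, Finset.card_product, card_D_AB hS hCne 1, hA, hB, hK1q]; · rfl
    rintro ⟨d, k⟩ hdk ⟨d', k'⟩ hdk' (h : d + k = d' + k')
    simp only [Finset.coe_product, Set.mem_prod, Finset.mem_coe] at hdk hdk'
    obtain ⟨a, ha, b, hb, rfl⟩ := mem_D.1 hdk.1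
    obtain ⟨a', ha', b', hb', rfl⟩ := mem_D.1 hdk'.1
    have hw : (a' - a) + (b - b') + ((-t1 + k) - (-t1 + k')) = 0 := by
      have : b - a + k - (b' - a' + k') = 0 := sub_eq_zero.2 h
      rw [← this]; abel
    obtain ⟨-, -, h1, h2, h3⟩ := hS 1 1 1 a ha a' ha' b' hb' b hb (-t1 + k') (memC1 k' hdk'.2) (-t1 + k) (memC1 k hdk.2) hw
    have hk : k' = k := by simpa using h3
    rw [h1, h2, hk]
  have hBK : #(B 1 + K) = 12 := by
    rw [← Finset.image_add_product, Finset.card_image_of_injOn, Finset.card_product, hB, hK1q]; · rfl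
    rintro ⟨b, k⟩ hbk ⟨b', k'⟩ hbk' (h : b + k = b' + k')
    simp only [Finset.coe_product, Set.mem_prod, Finset.mem_coe] at hbk hbk'
    obtain ⟨a, ha⟩ := hAne 1
    have hw : (a - a) + (b - b') + ((-t1 + k) - (-t1 + k')) = 0 := by
      have : b + k - (b' + k') = 0 := sub_eq_zero.2 h
      rw [← this]; abel
    obtain ⟨-, -, -, h2, h3⟩ := hS 1 1 1 a ha a ha b' hbk'.1 b hbk.1 (-t1 + k') (memC1 k' hbk'.2) (-t1 + k) (memC1 k hbk.2) hw
    have hk : k' = k := by simpa using h3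
    rw [h2, hk]
  -- Kneser twice with stabilizers ⊇ K (d a multiple of 4 dividing 52, i.e. d ∈ {4, 52})
  set X := -(D A C 2 + K) with hX
  set Y := D A B 1 + K with hY
  set Z := -(B 1 + K) with hZ
  have hXne : X.Nonempty := ((D_nonempty (hAne 2) (hCne 2)).add hKne).neg
  have hYne : Y.Nonempty := (D_nonempty (hAne 1) (hBne 1)).add hKne
  have hZne : Z.Nonempty := ((hBne 1).add hKne).neg
  have hXper : X + K = X := neg_add_carrier_add_carrier hK1 _
  have hXYge : 44 ≤ #(X + Y) := by
    obtain ⟨d, hKd, hdvd, hk⟩ := exists_dvd_kneserLB_le_card_add_of_periodic hK1 hXper hXne hYne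
    rw [hX, hY, Finset.card_neg, hD2, hD1, hH, hK1q] at *
    have hmem : d ∈ (Nat.divisors 52).filter (fun d => 4 ∣ d) := Finset.mem_filter.2 ⟨Nat.mem_divisors.2 ⟨hdvd, by norm_num⟩, hKd⟩
    exact le_trans ((by decide : ∀ d ∈ (Nat.divisors 52).filter (fun d => 4 ∣ d), 44 ≤ kneserLB 24 24 d) d hmem) hk
  have hXYper : X + Y + K = X + Y := by rw [add_right_comm, hXper]
  have hUge : 52 ≤ #(X + Y + Z) := by
    obtain ⟨d, hKd, hdvd, hk⟩ := exists_dvd_kneserLB_le_card_add_of_periodic hK1 hXYper (hXne.add hYne) hZne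
    rw [hK1q, hH] at *
    have hZc : #Z = 12 := by rw [hZ, Finset.card_neg, hBK]
    rw [hZc] at hk
    have hmem : d ∈ (Nat.divisors 52).filter (fun d => 4 ∣ d) := Finset.mem_filter.2 ⟨Nat.mem_divisors.2 ⟨hdvd, by norm_num⟩, hKd⟩
    have h1 : kneserLB 44 12 d ≤ kneserLB #(X + Y) 12 d := kneserLB_mono_left 12 d hXYge
    exact le_trans ((by decide : ∀ d ∈ (Nat.divisors 52).filter (fun d => 4 ∣ d), 52 ≤ kneserLB 44 12 d) d hmem) (le_trans h1 hk)
  have hU : X + Y + Z = univ := Finset.eq_univ_of_card _ (le_antisymm (Finset.card_le_univ _) (hH ▸ hUge))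
  -- t1 ∈ U (−c = t1 for c = −t1 ∈ C₁) unfolds to the word a₂ − a₁ + b₁ − b₁′ + c₁ − c₂ (reading (−A,−C,−B), indices (2,1,1))
  have hmem : t1 ∈ X + Y + Z := hU ▸ Finset.mem_univ _
  obtain ⟨xy, hxy, z, hz, hsum⟩ := Finset.mem_add.1 hmem
  obtain ⟨x, hx, y, hy, rfl⟩ := Finset.mem_add.1 hxy
  rw [hX, Finset.mem_neg] at hx
  obtain ⟨x', hx', hxx⟩ := hx
  obtain ⟨d2, hd2, k2, hk2, rfl⟩ := Finset.mem_add.1 hx'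
  obtain ⟨a2, ha2, c2, hc2, rfl⟩ := mem_D.1 hd2
  obtain ⟨d1, hd1, k1, hk1, rfl⟩ := Finset.mem_add.1 hy
  obtain ⟨a1, ha1, b1, hb1, rfl⟩ := mem_D.1 hd1
  rw [hZ, Finset.mem_neg] at hz
  obtain ⟨z', hz', hzz⟩ := hz
  obtain ⟨b1', hb1', k3, hk3, rfl⟩ := Finset.mem_add.1 hz'
  have hc1 : -t1 + (k1 - k2 - k3) ∈ C 1 := memC1 _ (hK1.sub_mem (hK1.sub_mem hk1 hk2) hk3)
  have hword : (-a2 - -a1) + (-(-t1 + (k1 - k2 - k3)) - -c2) + (-b1 - -b1') = 0 := by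
    have e : x + (b1 - a1 + k1) + z = t1 := hsum
    rw [← hxx, ← hzz] at e
    have : -a2 - -a1 + (-(-t1 + (k1 - k2 - k3)) - -c2) + (-b1 - -b1') = -(-(c2 - a2 + k2) + (b1 - a1 + k1) + -(b1' + k3)) + t1 := by abel
    rw [this, e]; abel
  obtain ⟨h21, -⟩ := hR 2 1 1 (-a1) (by simpa using ha1) (-a2) (by simpa using ha2) (-c2) (by simpa using hc2)
    (-(-t1 + (k1 - k2 - k3))) (by simpa using hc1) (-b1') (by simpa using hb1') (-b1) (by simpa using hb1) hword
  exact absurd h21 (by decide)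

section Capstone

open Summit.MatrixMultiplication.OmegaCensus.KLister

/-- `222_234_243` is not realisable in any abelian group of order `52`. [cite: CohnKleinbergSzegedyUmans2005, Def. 5.1] -/
theorem notRealizable_card52_222_234_243 (hH : Fintype.card H = 52) :
    ¬ Realizable H ([(2, 2, 2), (2, 3, 4), (2, 4, 3)] : List Shape) := by
  intro h
  obtain ⟨A, B, C, hS, hc⟩ := h.out
  exact no_isSTPP_card52_222_234_243 hH A B C hS (fun i => by fin_cases i <;> exact (hc _).2.2.2.1)
    (fun i => by fin_cases i <;> exact (hc _).2.2.2.2.1) (fun i => by fin_cases i <;> exact (hc _).2.2.2.2.2)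

end Capstone

end Summit.MatrixMultiplication.OmegaCensus.CubeNB

namespace Summit.MatrixMultiplication.OmegaCensus.KLister

open Literature.Computability.AlgebraicComplexity
open Summit.MatrixMultiplication.OmegaCensus.CubeNB

/-- Residual dead list at order `52` after the coset clashes and the quotient kill (31 patterns). [folklore] -/
def deadN52q : List (List Shape) :=
  [[(2, 3, 4), (2, 3, 5)],
   [(2, 3, 4), (2, 4, 4)],
   [(2, 3, 4), (3, 2, 5)],
   [(2, 3, 4), (4, 2, 4)],
   [(3, 3, 3), (3, 3, 3)],
   [(1, 1, 2), (3, 3, 3), (3, 4, 2)],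
   [(1, 1, 5), (3, 4, 2), (3, 4, 2)],
   [(1, 1, 5), (3, 4, 2), (4, 3, 2)],
   [(1, 2, 3), (3, 3, 3), (5, 2, 2)],
   [(1, 2, 3), (4, 2, 3), (4, 2, 3)],
   [(1, 2, 3), (4, 3, 2), (4, 3, 2)],
   [(2, 2, 2), (2, 3, 3), (3, 3, 3)],
   [(2, 2, 2), (2, 3, 4), (2, 3, 4)],
   [(2, 2, 2), (2, 3, 4), (3, 2, 4)],
   [(2, 2, 3), (2, 3, 3), (2, 3, 4)],
   [(2, 2, 3), (2, 3, 3), (2, 4, 3)],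
   [(2, 2, 3), (2, 3, 3), (3, 2, 4)],
   [(2, 2, 3), (2, 3, 3), (4, 2, 3)],
   [(2, 2, 3), (2, 4, 3), (3, 3, 2)],
   [(2, 2, 3), (3, 3, 2), (3, 4, 2)],
   [(2, 2, 4), (2, 5, 2), (3, 3, 2)],
   [(2, 3, 3), (2, 3, 3), (2, 3, 3)],
   [(2, 3, 3), (2, 3, 3), (3, 2, 3)],
   [(2, 3, 3), (3, 2, 3), (3, 3, 2)],
   [(1, 1, 1), (1, 1, 4), (3, 4, 2), (3, 4, 2)],
   [(1, 1, 1), (1, 1, 4), (3, 4, 2), (4, 3, 2)],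
   [(1, 1, 1), (2, 2, 4), (2, 3, 3), (2, 3, 3)],
   [(1, 1, 1), (2, 2, 4), (3, 3, 2), (3, 3, 2)],
   [(1, 1, 2), (1, 1, 3), (3, 4, 2), (3, 4, 2)],
   [(1, 1, 2), (1, 1, 3), (3, 4, 2), (4, 3, 2)],
   [(2, 2, 2), (2, 2, 4), (2, 4, 2), (4, 2, 2)]]

/-- **Order `52` conditional capstone, residual list of 31** (was 52; `…_of_dead_c` had 32). [cite: CohnKleinbergSzegedyUmans2005, Def. 5.1] -/
theorem volume_le_of_card_eq_52_of_dead_q {H : Type*} [AddCommGroup H] [Fintype H] [DecidableEq H] (hH : Fintype.card H = 52)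
    (hdead : ∀ D ∈ deadN52q, ¬ Realizable H D)
    {m : ℕ} (A B C : Fin m → Finset H) (hS : IsSTPP A B C) : ∑ i, #(A i) * #(B i) * #(C i) ≤ 52 := by
  refine volume_le_of_card_eq_52_of_dead_c hH ?_ A B C hS
  intro D hD
  simp only [deadN52c, List.mem_cons, List.not_mem_nil, or_false] at hD
  rcases hD with rfl | rfl | rfl | rfl | rfl | rfl | rfl | rfl | rfl | rfl | rfl | rfl | rfl | rfl | rfl | rfl | rfl | rfl | rfl | rfl | rfl | rfl | rfl | rfl | rfl | rfl | rfl | rfl | rfl | rfl | rfl | rfl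
  · exact hdead _ (by simp [deadN52q])
  · exact hdead _ (by simp [deadN52q])
  · exact hdead _ (by simp [deadN52q])
  · exact hdead _ (by simp [deadN52q])
  · exact hdead _ (by simp [deadN52q])
  · exact hdead _ (by simp [deadN52q])
  · exact hdead _ (by simp [deadN52q])
  · exact hdead _ (by simp [deadN52q])
  · exact hdead _ (by simp [deadN52q])
  · exact hdead _ (by simp [deadN52q])
  · exact hdead _ (by simp [deadN52q])
  · exact hdead _ (by simp [deadN52q])
  · exact hdead _ (by simp [deadN52q])
  · exact notRealizable_card52_222_234_243 hH
  · exact hdead _ (by simp [deadN52q])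
  · exact hdead _ (by simp [deadN52q])
  · exact hdead _ (by simp [deadN52q])
  · exact hdead _ (by simp [deadN52q])
  · exact hdead _ (by simp [deadN52q])
  · exact hdead _ (by simp [deadN52q])
  · exact hdead _ (by simp [deadN52q])
  · exact hdead _ (by simp [deadN52q])
  · exact hdead _ (by simp [deadN52q])
  · exact hdead _ (by simp [deadN52q])
  · exact hdead _ (by simp [deadN52q])
  · exact hdead _ (by simp [deadN52q])
  · exact hdead _ (by simp [deadN52q])
  · exact hdead _ (by simp [deadN52q])
  · exact hdead _ (by simp [deadN52q])
  · exact hdead _ (by simp [deadN52q])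
  · exact hdead _ (by simp [deadN52q])
  · exact hdead _ (by simp [deadN52q])

end Summit.MatrixMultiplication.OmegaCensus.KLister
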